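import Summits.BirchSwinnertonDyer.Rank1Residual.Additive.SignedConditionToLocalKummer
import HarnessLib

/-!
# Minus classes across the layers, and strict ⟹ zero clause for Kummer witnesses (generic `K`, any
# model `E`; cell `b2b-bsdres`, CLASS-CLOSURE lane, class O10 — x1b GEN 42, class lead; file 106 of
# the series: the two generic inputs of the final assembly, file 107)

HONEST FRAMING (cell `b2b-bsdres`, run/shared/lean/b2b/bsd-rank1-residual/, verbatim in every
file): the goal of the cell is to DELETE the COMBINATION-SHAPED residual classes of the
Birch–Swinnerton-Dyer formula for ALL analytic-rank `≤ 1` elliptic curves over `ℚ` — "full BSD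
formula for every rank `≤ 1` curve in class `C`" assembled STRICTLY from published theorems — so
that the rank-`≤ 1` remainder becomes exactly the CONSTRUCTION-SHAPED classes, which are TYPED
(missing-input `Prop`s), NOT attempted. This is not "finishing BSD". CLASS-CLOSURE lane: prove
what is provable now; shrink each hard class to its core with data; no claim beyond stated classes;
research routes on CONSTRUCTION-SHAPED X12 / O10; census / instrument output = EVIDENCE / conjecture
items, NEVER a Literature fact; `RESIDUAL-MAP.md` marks change only by signed lines. THIS FILE:
TOOL THEOREMS ONLY — no definition, no named Literature fact, no Summits-side fact `def … : Prop`,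
no `sorry`, axioms standard; UNCONDITIONAL (pure Galois-module
bookkeeping); nothing is booked; no label / mark / count / sub-cell moves; (C1_η), (C2_η-GZ), (C3_η)
stay typed as filed (cc-typer-6's pen); nothing about `BSD(W, p)` of any pair is claimed.

## What

The count (C) of file 100 needs, at `v₀`, `loc_{v₀}(Ψ_m⁻¹A₀) ⊆ C` for the minus line `C`; file 86
produces, for a class of `A₀`, a Kummer witness `(x, R, φ)` at SOME layer `n₁` with `x` a STRICT
minus point, while the minus line of file 98 is generated by witnesses with ZERO-CLAUSE minus points
at a FIXED layer `n`.  This file bridges the two gaps: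

* `closure_minus_mono` — the minus classes of layer `k` are minus classes of every layer `n ≥ k`
  (`zeroClause_mono`; the layer subgroups decrease), so the generated subgroups increase with `n`.
* `mem_closure_minus_of_strictSigned_kummer` — a class represented on `Gal(K̄_E/K_n·E)` by the
  Kummer cocycle of a `p^m`-th root `R` of a STRICT minus point `x` is a minus class, provided
  `E(K_∞·E)` has no `p`-power torsion: `T = Tr_{n/0} x ∈ E(E)` is torsion of order `p^a·M`,
  `p ∤ M`, and `p^a (M T) = 0` forces `M T = 0`; with `N' = M u ≡ 1 (mod p^{m+1})` the witness
  `(x, R, φ)` is replaced by `(N'x, N'R, N'φ)` (`Tr_{n/0}(N'x) = 0`, `p^m (N'R) = N'x`,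
  `[N'φ] = N'[φ] = [φ]`) — the witness surgery of n1011-p17's
  `localKummerOverOfEmb_strictSigned_eq_zeroClause`, at the level of minus classes.
* `natCard_ker_nsmul_pow_eq_one` — `#A[p^k] = 1` in a group without `p`-torsion.

References: [Kobayashi2003] §2 p. 4, Def. 2.1 (p. 5), Prop. 8.7 (p. 16), Lemma 8.17 (p. 19);
[SerreGaloisCohomology1997] I §2.4.
-/

noncomputable section

open scoped Classical

open Field WeierstrassCurve
open Literature.NumberTheory.EllipticCurves
open Literature.NumberTheory.GaloisRepresentations
open Literature.NumberTheory.EllipticCurves.Kobayashi2003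
open Summit.BirchSwinnertonDyer.Rank1Residual.X11b.Levels
open Summit.BirchSwinnertonDyer.Rank1Residual.X11b
open scoped ContRepresentation

namespace Summit.BirchSwinnertonDyer.Rank1Residual.Additive.LevelBridge

universe u

/-! ### §1 Monotonicity of the minus classes in the layer; strict ⟹ zero clause -/

section Minus

variable {K : Type u} [Field K] (W : WeierstrassCurve K) {p : ℕ} [hp : Fact p.Prime]
  (κ : ZpExtension K p) (E : Type u) [Field E] [Algebra K E]

/-- **The minus classes of layer `k` are minus classes of every layer `n ≥ k`** (a zero-clause minus
point of layer `k` is one of layer `n`, `zeroClause_mono`; the layer subgroups decrease), hence the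
generated subgroups increase with the layer. [cite: Kobayashi2003, §2 p. 4 and Def. 2.1 (p. 5)] -/
theorem closure_minus_mono {ℓ : ℤ} {k n : ℕ} (hkn : k ≤ n) :
    AddSubgroup.closure {ξ : galoisCohomology (GaloisRep.restrictField E (W.torsionGaloisModule ℓ)) 1 |
        ∃ x ∈ signedLocalPointsOfEmb κ (closureEmb (K := K) E) W (-1) k ⊓
          (localTraceOfEmb κ (closureEmb (K := K) E) W 0 k).ker,
        ∃ R : localPoints W E, ℓ • R = x ∧
        ∃ φ : contOneCocycles (DiscreteGaloisModule.toTopRep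
            (GaloisRep.restrictField E (W.torsionGaloisModule ℓ))),
          oneCocycleClass _ φ = ξ ∧
          ∀ u ∈ localLayerSubgroupOfEmb κ (closureEmb (K := K) E) k,
            pointsMap W E ((φ.1 u : geomTorsion W ℓ) : geomPoints W) = u • R - R} ≤
      AddSubgroup.closure {ξ : galoisCohomology (GaloisRep.restrictField E (W.torsionGaloisModule ℓ)) 1 |
        ∃ x ∈ signedLocalPointsOfEmb κ (closureEmb (K := K) E) W (-1) n ⊓
          (localTraceOfEmb κ (closureEmb (K := K) E) W 0 n).ker,
        ∃ R : localPoints W E, ℓ • R = x ∧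
        ∃ φ : contOneCocycles (DiscreteGaloisModule.toTopRep
            (GaloisRep.restrictField E (W.torsionGaloisModule ℓ))),
          oneCocycleClass _ φ = ξ ∧
          ∀ u ∈ localLayerSubgroupOfEmb κ (closureEmb (K := K) E) n,
            pointsMap W E ((φ.1 u : geomTorsion W ℓ) : geomPoints W) = u • R - R} := by
  refine AddSubgroup.closure_mono ?_
  rintro ξ ⟨x, hx, R, hR, φ, hφ, hφu⟩
  exact ⟨x, StrictSignedCount.zeroClause_mono κ (closureEmb (K := K) E) W hkn hx, R, hR, φ, hφ,
    fun u hu => hφu u (localLayerSubgroupOfEmb_antitone κ (closureEmb (K := K) E) hkn hu)⟩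

/-- **A class represented on `Gal(K̄_E/K_n·E)` by the Kummer cocycle of a `p^m`-th root `R` of a
STRICT minus point `x` is a minus class (zero clause)**, provided `E(K_∞·E)` has no `p`-power
torsion: `T = Tr_{n/0} x ∈ E(E)` is torsion of order `p^a·M`, `p ∤ M`, and `p^a (M T) = 0` forces
`M T = 0`; with `N' = M u ≡ 1 (mod p^{m+1})` the witness `(x, R, φ)` is replaced by
`(N'x, N'R, N'φ)`: `Tr_{n/0}(N'x) = 0`, `p^m (N'R) = N'x`, `[N'φ] = N'[φ] = [φ]` (`p^m [φ] = 0`).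
(The witness surgery of n1011-p17's `localKummerOverOfEmb_strictSigned_eq_zeroClause`.)
[cite: Kobayashi2003, §2 p. 4, Def. 2.1 (p. 5), Prop. 8.7 (p. 16)] -/
theorem mem_closure_minus_of_strictSigned_kummer {m : ℕ} (n : ℕ)
    (htorsInf : ∀ P ∈ localFixedPointsOfEmb (closureEmb (K := K) E) W κ.kerSubgroup,
      ∀ j : ℕ, p ^ j • P = 0 → P = 0)
    {ξ : galoisCohomology (GaloisRep.restrictField E (W.torsionGaloisModule ((p ^ m : ℕ) : ℤ))) 1}
    {x : localPoints W E} (hx : x ∈ strictSignedLocalPointsOfEmb κ (closureEmb (K := K) E) W (-1) n)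
    {R : localPoints W E} (hR : ((p ^ m : ℕ) : ℤ) • R = x)
    (φ : contOneCocycles (DiscreteGaloisModule.toTopRep
      (GaloisRep.restrictField E (W.torsionGaloisModule ((p ^ m : ℕ) : ℤ)))))
    (hφ : oneCocycleClass _ φ = ξ)
    (hφu : ∀ u ∈ localLayerSubgroupOfEmb κ (closureEmb (K := K) E) n,
      pointsMap W E ((φ.1 u : geomTorsion W ((p ^ m : ℕ) : ℤ)) : geomPoints W) = u • R - R) :
    ξ ∈ AddSubgroup.closure {ξ : galoisCohomology
        (GaloisRep.restrictField E (W.torsionGaloisModule ((p ^ m : ℕ) : ℤ))) 1 |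
        ∃ x ∈ signedLocalPointsOfEmb κ (closureEmb (K := K) E) W (-1) n ⊓
          (localTraceOfEmb κ (closureEmb (K := K) E) W 0 n).ker,
        ∃ R : localPoints W E, ((p ^ m : ℕ) : ℤ) • R = x ∧
        ∃ φ : contOneCocycles (DiscreteGaloisModule.toTopRep
            (GaloisRep.restrictField E (W.torsionGaloisModule ((p ^ m : ℕ) : ℤ)))),
          oneCocycleClass _ φ = ξ ∧
          ∀ u ∈ localLayerSubgroupOfEmb κ (closureEmb (K := K) E) n,
            pointsMap W E ((φ.1 u : geomTorsion W ((p ^ m : ℕ) : ℤ)) : geomPoints W) = u • R - R} := by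
  set ι := closureEmb (K := K) E with hι
  have hp' : p.Prime := hp.out
  obtain ⟨hxs, hT⟩ := (mem_strictSignedLocalPointsOfEmb_iff κ ι W (-1) n x).mp hx
  set T := localTraceOfEmb κ ι W 0 n x with hTdef
  have hTfin : IsOfFinAddOrder T := (AddCommGroup.mem_torsion _).mp (hT rfl)
  -- `addOrderOf T = p ^ a * M`, `p ∤ M`
  obtain ⟨a, M, hM, hNM⟩ :=
    Nat.exists_eq_pow_mul_and_not_dvd hTfin.addOrderOf_pos.ne' p hp'.one_lt.ne'
  -- `T ∈ E(E) ≤ E(K_∞·E)`, so `M • T = 0`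
  have hx0 : x ∈ localLayerPointsOfEmb κ ι W n :=
    strictSignedLocalPointsOfEmb_le_localLayerPoints κ ι W (-1) n hx
  have hT0 : T ∈ localLayerPointsOfEmb κ ι W 0 := localTraceOfEmb_mem_of_mem κ ι W 0 n hx0
  have hTinf : T ∈ localFixedPointsOfEmb ι W κ.kerSubgroup :=
    localFixedPointsOfEmb_antitone ι W (κ.kerSubgroup_le_layerSubgroup 0) hT0
  have hMT : M • T = 0 := by
    refine htorsInf (M • T) (AddSubgroup.nsmul_mem _ hTinf M) a ?_
    rw [smul_smul, ← hNM]
    exact addOrderOf_nsmul_eq_zero T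
  -- `N' = M * u ≡ 1 mod p^(m+1)`; `N' • ξ = ξ`
  have hcop : Nat.Coprime M (p ^ (m + 1)) :=
    (Nat.Coprime.pow_right (m + 1) ((Nat.Prime.coprime_iff_not_dvd hp').mpr hM).symm)
  obtain ⟨u, -, hu⟩ := Nat.exists_mul_mod_eq_one_of_coprime hcop
    (Nat.one_lt_pow (Nat.succ_ne_zero m) hp'.one_lt)
  set N' := M * u with hN'
  have hmξ : p ^ m • ξ = 0 :=
    galoisCohomology.nsmul_eq_zero_of_forall _ (pow_nsmul_geomTorsion_eq_zero W p m) ξ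
  have hm1ξ : p ^ (m + 1) • ξ = 0 := by rw [pow_succ', mul_nsmul', hmξ, nsmul_zero]
  have hN'ξ : N' • ξ = ξ := by
    have h := Nat.div_add_mod N' (p ^ (m + 1))
    rw [hu] at h
    calc N' • ξ = (p ^ (m + 1) * (N' / p ^ (m + 1)) + 1) • ξ := by rw [h]
      _ = ξ := by rw [add_nsmul, one_nsmul, mul_nsmul, hm1ξ, nsmul_zero, zero_add]
  -- the new witness `(N' • x, N' • R, N' • φ)`
  refine AddSubgroup.subset_closure ⟨N' • x, ?_, N' • R, ?_, (N' : ℤ) • φ, ?_, fun v hv ↦ ?_⟩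
  · refine AddSubgroup.mem_inf.mpr ⟨AddSubgroup.nsmul_mem _ hxs _, (AddMonoidHom.mem_ker).mpr ?_⟩
    rw [map_nsmul, ← hTdef, hN', mul_comm, ← smul_smul, hMT, smul_zero]
  · rw [smul_comm, hR]
  · rw [oneCocycleClass_smul, hφ, Nat.cast_smul_eq_nsmul]
    exact hN'ξ
  · have hval : ((((N' : ℤ) • φ).1 v : geomTorsion W ((p ^ m : ℕ) : ℤ)) : geomPoints W) =
        N' • ((φ.1 v : geomTorsion W ((p ^ m : ℕ) : ℤ)) : geomPoints W) := by
      rw [Submodule.coe_smul, ContinuousMap.smul_apply, natCast_zsmul, AddSubmonoidClass.coe_nsmul]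
    rw [hval, map_nsmul, hφu v hv, smul_sub, smul_comm v N' R]

end Minus

section Card

variable {A : Type*} [AddCommGroup A] {p : ℕ}

/-- In a group without `p`-torsion, `#A[p^k] = 1`. [folklore] -/
theorem natCard_ker_nsmul_pow_eq_one (htors : ∀ X : A, p • X = 0 → X = 0) (k : ℕ) :
    Nat.card (nsmulAddMonoidHom (p ^ k) : A →+ A).ker = 1 := by
  have h : (nsmulAddMonoidHom (p ^ k) : A →+ A).ker = ⊥ := by
    rw [eq_bot_iff]
    intro X hX
    rw [AddMonoidHom.mem_ker, nsmulAddMonoidHom_apply] at hX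
    rw [AddSubgroup.mem_bot]
    induction k with
    | zero => rwa [pow_zero, one_smul] at hX
    | succ k ih => exact ih (htors _ (by rwa [pow_succ, mul_comm, mul_smul] at hX))
  rw [h, AddSubgroup.card_bot]

end Card

end Summit.BirchSwinnertonDyer.Rank1Residual.Additive.LevelBridge

end
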